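import Literature.NumberTheory.Sieve.FGKMT2018AssemblyBridges
import Literature.NumberTheory.Sieve.FGKMT2018Theorem4Params
import HarnessLib

/-!
# Ford–Green–Konyagin–Maynard–Tao 2018 — §6: the size bound (4.5)′ `#(𝒬 ∩ S(a⃗)) ≤ 100 c x log₂x/log x`
# holds for all but a proportion `≤ 0.82` of the `a⃗` (PROVED: expectation `σ|𝒬|` by PNT + (6.9), Markov)

Topic `Literature/NumberTheory/Sieve`. Source: K. Ford, B. Green, S. Konyagin, J. Maynard, T. Tao,
*Long gaps between primes*, J. Amer. Math. Soc. 31 (2018) 65–105 = arXiv:1412.5029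
[FordGreenKonyaginMaynardTao2018], §6 p. 18: «From Lemma 6.1 we have `E#(𝒬 ∩ S(a⃗)) = σ|𝒬|`
… (Corollary 4) with probability …»; (4.11) p. 14 / (6.9) p. 17: `σ y = (1 + O(1/log₂^{10} x)) 80 c x log₂ x`,
`|𝒬| ≤ (1 + o(1)) y/log x` (prime number theorem).

This file PROVES: `boxExp_card_sievedQ_le` — for fixed `c > 0` and large `x`,
`E_{a⃗} #(𝒬 ∩ S(a⃗)) = σ|𝒬| ≤ 82 c x log₂ x/log x` (tree PNT `LFunctions.primeCounting_isEquivalent_holds`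
via `FGKMT2018Theorem4Params.card_primesQ_le`, and (6.9) `FGKMT2018SigmaBounds.sigma_mul_ySieve_asymp`);
`card_box_sievedQ_gt_le` — the `a⃗` violating (4.5)′ `#(𝒬 ∩ S(a⃗)) ≤ 100 c x log₂ x/log x` are at most
a proportion `82/100` of the box (Markov; the first of the three bad events of the assembly
Theorem 5 ⟹ Theorem 4).
-/

noncomputable section

open Finset Filter

namespace Literature.NumberTheory.Sieve

namespace FGKMT2018

/-- `log^[2] t = log log t`. [folklore] -/
private theorem iter_two' (t : ℝ) : Real.log^[2] t = Real.log (Real.log t) := by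
  simp [Function.iterate_succ_apply']

/-- **`E_{a⃗} #(𝒬 ∩ S(a⃗)) = σ|𝒬| ≤ 82 c x log₂ x/log x`** for fixed `c > 0`, large `x`.
[cite: FordGreenKonyaginMaynardTao2018, Lemma 6.1/Corollary 4 p. 18 with (6.9) p. 17 and (4.5) p. 11] -/
theorem boxExp_card_sievedQ_le {c : ℝ} (hc : 0 < c) : ∀ᶠ x : ℕ in atTop,
    boxExp (primesS x) (fun f => (#(sievedQ c x (extendRes (primesS x) f)) : ℝ)) ≤
      82 * c * x * Real.log (Real.log x) / Real.log x := by
  filter_upwards [sigma_mul_ySieve_asymp (show (0 : ℝ) < 1 / 100 by norm_num),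
    card_primesQ_le hc, params_growth] with x hσy hQ hg
  obtain ⟨h1, h2, -⟩ := hg
  have hS : ∀ s ∈ primesS x, 0 < s := fun s hs => (prime_of_mem_primesS hs).pos
  have hL0 : 0 < Real.log x := by linarith
  have hx0 : (0 : ℝ) ≤ x := Nat.cast_nonneg _
  have hσ0 : 0 ≤ sigma x := (sigma_pos x).le
  have hup := (hσy c hc).2
  rw [iter_two'] at hup
  rw [boxExp_card_sievedQ hS, ← sigma_eq_sigmaProd]
  calc sigma x * (#(primesQ c x) : ℝ) ≤ sigma x * (101 / 100 * ySieve c x / Real.log x) :=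
        mul_le_mul_of_nonneg_left hQ hσ0
    _ = 101 / 100 * (sigma x * ySieve c x) / Real.log x := by ring
    _ ≤ 101 / 100 * ((1 + 1 / 100) * (80 * c * x * Real.log (Real.log x))) / Real.log x := by
        refine div_le_div_of_nonneg_right (mul_le_mul_of_nonneg_left hup (by norm_num)) hL0.le
    _ ≤ 82 * c * x * Real.log (Real.log x) / Real.log x := by
        refine div_le_div_of_nonneg_right ?_ hL0.le
        have : 0 ≤ c * x * Real.log (Real.log x) := by positivity
        nlinarith

/-- **(4.5)′ fails for at most `82%` of the `a⃗`**: for fixed `c > 0` and large `x`,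
`#{a⃗ : #(𝒬 ∩ S(a⃗)) > 100 c x log₂ x/log x} ≤ (82/100) ∏_{s ∈ 𝒮} s` (Markov).
[cite: FordGreenKonyaginMaynardTao2018, Corollary 4 p. 18 and (4.5) p. 11] -/
theorem card_box_sievedQ_gt_le {c : ℝ} (hc : 0 < c) : ∀ᶠ x : ℕ in atTop,
    (#((residueBox (primesS x)).filter fun f =>
        100 * c * x * Real.log (Real.log x) / Real.log x ≤
          (#(sievedQ c x (extendRes (primesS x) f)) : ℝ)) : ℝ) ≤
      82 / 100 * ∏ s ∈ primesS x, (s : ℝ) := by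
  filter_upwards [boxExp_card_sievedQ_le hc, params_growth] with x hE hg
  obtain ⟨h1, h2, -⟩ := hg
  have hS : ∀ s ∈ primesS x, 0 < s := fun s hs => (prime_of_mem_primesS hs).pos
  have hL0 : 0 < Real.log x := by linarith
  have hx0 : (0 : ℝ) < x := by
    rcases Nat.eq_zero_or_pos x with hx | hx
    · subst hx; simp at h1; linarith
    · exact_mod_cast hx
  have ht : 0 < 100 * c * x * Real.log (Real.log x) / Real.log x := by positivity
  have hprod : 0 ≤ ∏ s ∈ primesS x, (s : ℝ) := Finset.prod_nonneg fun s _ => Nat.cast_nonneg _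
  refine (card_box_sievedQ_ge_le hS ht).trans ?_
  rw [← boxExp_card_sievedQ hS]
  refine mul_le_mul_of_nonneg_right ?_ hprod
  rw [div_le_iff₀ ht]
  refine hE.trans (le_of_eq ?_)
  field_simp

end FGKMT2018

end Literature.NumberTheory.Sieve
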